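import Summits.NavierStokesRegularity.NavierStokesRegularity.Theses.AdiabaticEddy

/-!
# Crux NoFrozenEddyCollapse (stmt-NavierStokesRegularity-1431) — ideator 1, round 1
# Sketch for idea card `shell-balance-edge-torsion`

First-lemma signatures (statements only, no proofs):

* `IsCompactSteadyEuler`, `bernoulli`, `frozenDrift`, `adjointDrift` — the objects.
* `ShellEnergyBalance`, `ShellHelicityBalance` — the two Bernoulli-shell balance laws (E), (H)
  that a QUIET frozen eddy must satisfy (cokernel-tested log-window law).
* `NoShellBalance` — FIRST LEMMA of the card (Euler-side rigidity; the edge-torsion lemma is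
  the proposed proof): no nonzero smooth compactly supported steady Euler field satisfies (E)+(H).
* `Recentre` — modulation lemma: WLOG the centre path is C¹ and the fluctuation is
  L²-orthogonal to the three translation modes ∂ⱼU (kills the frame-velocity term exactly).
* `WindowLaw` — the exact cokernel-tested balance in physical time for φ = f(B)U:
  d/dt ⟨V(t), φ⟩ = (A/L)·⟨W ⊗ W, ∇φ⟩ + (ℓ(T−t))⁻¹ ⟨V, 𝓛*φ⟩ (no linear fluctuation term, no
  pressure term, no frame term), integrated over [t₁, t₂].
* `crux_of_quiet` — how the pieces compose (informal target of crux-plan; stated as a Prop).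
-/

namespace Summit.NavierStokesRegularity.NavierStokesRegularity.Cruxes.NoFrozenEddyCollapse.ShellBalanceEdgeTorsion

open scoped BigOperators Topology Classical InnerProductSpace
open Filter Set Function MeasureTheory intervalIntegral

local notation "E³" => EuclideanSpace ℝ (Fin 3)

open Literature.Analysis.FluidPDE

/-- Smooth compactly supported steady Euler pair `(U, P)` on `ℝ³` (the profile class of the
crux: `ContDiff`, `HasCompactSupport U`, `IsDivFree U`, `U·∇U + ∇P = 0`). -/
def IsCompactSteadyEuler (U : E³ → E³) (P : E³ → ℝ) : Prop :=
  ContDiff ℝ (⊤ : ℕ∞) U ∧ ContDiff ℝ (⊤ : ℕ∞) P ∧ HasCompactSupport U ∧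
    VectorCalculus.IsDivFree U ∧ ∀ x, convect U U x + gradient P x = 0

/-- Bernoulli head `B = P + |U|²/2` of the profile; `U × curl U = ∇B`, so `B` is constant on
stream- and vortex-lines and its level sets are the invariant tori (Arnold). -/
noncomputable def bernoulli (U : E³ → E³) (P : E³ → ℝ) (y : E³) : ℝ :=
  P y + ‖U y‖ ^ 2 / 2

/-- The frozen-eddy drift `𝓛̃U = ΔU − αℓ²U − (ℓ²/2)(y·∇)U`: the O(1/Re) forcing a profile frozen
at amplitude `(T−t)^{−α}` and Leray length `ℓ√(ν(T−t))` feels in its own frame (viscosity,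
amplitude renormalisation, self-similar collapse), multiplied by `ℓ`. -/
noncomputable def frozenDrift (α ℓ : ℝ) (U : E³ → E³) (y : E³) : E³ :=
  Laplacian.laplacian U y - (α * ℓ ^ 2) • U y - (ℓ ^ 2 / 2) • (fderiv ℝ U y) y

/-- Formal `L²`-adjoint of `ℓ⁻¹Δ − αℓ − (ℓ/2)(y·∇)` on divergence-free fields:
`𝓛*φ = ℓ⁻¹Δφ − αℓφ + (ℓ/2)(3φ + (y·∇)φ)`. -/
noncomputable def adjointDrift (α ℓ : ℝ) (φ : E³ → E³) (y : E³) : E³ :=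
  ℓ⁻¹ • Laplacian.laplacian φ y - (α * ℓ) • φ y + (ℓ / 2) • ((3 : ℝ) • φ y + (fderiv ℝ φ y) y)

/-- (E) SHELL ENERGY BALANCE: `⟨𝓛̃U, f(B)U⟩ = 0` for every smooth `f` — the frozen drift does
not change the kinetic energy of any Bernoulli shell (`f(B)U` lies in the cokernel of the
linearised steady Euler operator: `−U·∇(fU) + (∇U)ᵀ(fU) = ∇F(B)`). Equivalent shell form:
`∫ f(B)[U·ΔU + ℓ²(3/4−α)|U|²] + (ℓ²/4)∫ f′(B)|U|²(y·∇B) = 0`. -/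
def ShellEnergyBalance (α ℓ : ℝ) (U : E³ → E³) (P : E³ → ℝ) : Prop :=
  ∀ f : ℝ → ℝ, ContDiff ℝ (⊤ : ℕ∞) f →
    ∫ y, inner ℝ (frozenDrift α ℓ U y) (f (bernoulli U P y) • U y) = 0

/-- (H) SHELL HELICITY BALANCE: `⟨𝓛̃U, g(B) curl U⟩ = 0` for every smooth `g` (`g(B) curl U` is
in the cokernel exactly). Equivalent shell form:
`∫ g(B) curl U·curl curl U = −ℓ²(α−½) ∫ g(B) U·curl U`: on EVERY Bernoulli shell superhelicity
and helicity are anti-correlated with the fixed ratio `ℓ²(α−½)`. -/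
def ShellHelicityBalance (α ℓ : ℝ) (U : E³ → E³) (P : E³ → ℝ) : Prop :=
  ∀ g : ℝ → ℝ, ContDiff ℝ (⊤ : ℕ∞) g →
    ∫ y, inner ℝ (frozenDrift α ℓ U y) (g (bernoulli U P y) • curl U y) = 0

/-- FIRST LEMMA (Euler-side rigidity, the card's transfer target for the QUIET class):
no nonzero smooth compactly supported steady Euler flow satisfies both shell balances for any
`α ∈ (1/2, 3/4)`, `ℓ > 0`. Proposed proof: EDGE TORSION — at the flat compact edge of `supp U`,
(E) forces the direction of `U` to rotate across Bernoulli leaves at rate exactly `|A′/A|`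
(frozen-shape edges realise only HALF the required layer dissipation: `∫₀^d A′² ≈ ½AA′`), while
(H) forces the vorticity direction not to rotate at that rate (`c′ = −L(c+c³)` has no admissible
solution); Beltrami edges die by sign (`λ² = −ℓ²(α−½)`). Cheapest falsifier: evaluate (E) with
`f = 𝟙_{B<β}` on a Gavrilov/Constantin–La–Vicol flow cut off by a flat `χ(P)`: the ratio
`∫_{B<β}|∇U|² / ∫_{B=β}∂_ν(|U|²/2)` tends to `1/2`, not `1`. -/
def NoShellBalance : Prop :=
  ∀ α ∈ Set.Ioo (1 / 2 : ℝ) (3 / 4), ∀ ℓ : ℝ, 0 < ℓ →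
    ∀ (U : E³ → E³) (P : E³ → ℝ), IsCompactSteadyEuler U P →
      ShellEnergyBalance α ℓ U P → ShellHelicityBalance α ℓ U P → U = 0

/-- The rescaled field `V(t, y) = (T−t)^α u(t, ξ(t) + ℓ√(ν(T−t)) y)` of the crux. -/
noncomputable def rescaled (ν T α ℓ : ℝ) (ξ : ℝ → E³) (u : ℝ → E³ → E³) (t : ℝ) (y : E³) : E³ :=
  ((T - t) ^ α) • u t (ξ t + (ℓ * Real.sqrt (ν * (T - t))) • y)

/-- MODULATION LEMMA (`Recentre`): under the hypotheses of `NoFrozenEddyCollapse` with `U ≠ 0`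
one may replace the (arbitrary!) centre path `ξ` by a path `ξ'` with `|ξ' − ξ| = o(L)`, `C¹`
near `T`, for which the fluctuation `W = V − U` is `L²`-orthogonal to the translation modes
`∂ⱼU` (implicit function theorem on `z ↦ ⟨V(t, · + z), ∂ⱼU⟩`, whose differential tends to the
Gram matrix `(∫ ∂ⱼU·∂ₖU)`, positive definite for compactly supported `U ≠ 0`). This kills the
frame-velocity term `⟨W ⊗ ξ̇/A, ∇φ⟩` EXACTLY in every cokernel-tested balance. -/
def Recentre : Prop :=
  ∀ ν : ℝ, 0 < ν → ∀ T : ℝ, 0 < T → ∀ (u : ℝ → E³ → E³) (p : ℝ → E³ → ℝ),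
    IsClassicalNSSolutionOn (Set.Ico 0 T) ν 0 u p → IsLerayHopfOn T ν 0 (u 0) u →
    HasRapidSpatialDecay (u 0) →
    ∀ (U : E³ → E³) (P : E³ → ℝ), IsCompactSteadyEuler U P → U ≠ 0 →
    ∀ α ∈ Set.Ioo (1 / 2 : ℝ) (3 / 4), ∀ ℓ : ℝ, 0 < ℓ → ∀ ξ : ℝ → E³,
      TendstoLocallyUniformly (rescaled ν T α ℓ ξ u) U (𝓝[<] T) →
      ∃ ξ' : ℝ → E³,
        TendstoLocallyUniformly (rescaled ν T α ℓ ξ' u) U (𝓝[<] T) ∧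
        Tendsto (fun t => (ℓ * Real.sqrt (ν * (T - t)))⁻¹ • (ξ' t - ξ t)) (𝓝[<] T) (𝓝 0) ∧
        (∀ᶠ t in 𝓝[<] T, DifferentiableAt ℝ ξ' t) ∧
        ∀ᶠ t in 𝓝[<] T, ∀ j : Fin 3,
          ∫ y, inner ℝ (rescaled ν T α ℓ ξ' u t y - U y)
              (fderiv ℝ U y (EuclideanSpace.single j (1 : ℝ))) = 0

/-- WINDOW LAW (exact cokernel-tested balance, physical time, `φ = f(B)U`): for a recentred
frozen-eddy datum and `t₁ ≤ t₂ < T` late enough,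
`⟨V(t₂) − V(t₁), φ⟩ = ∫_{t₁}^{t₂} [ (T−t)^{−α}/L(t) · ⟨W⊗W, ∇φ⟩ + (ℓ(T−t))⁻¹ ⟨V, 𝓛*φ⟩ ] dt`,
`W = V − U`, `L = ℓ√(ν(T−t))`: the linear fluctuation terms vanish identically (cokernel),
the pressure pairs to zero (`φ` divergence-free, compactly supported), the frame term vanishes
by `Recentre`. The left side and `⟨V, 𝓛*φ⟩ → ⟨U, 𝓛*φ⟩` are C⁰-controlled; `∫ dt/(ℓ(T−t))`
diverges logarithmically; hence the DICHOTOMY: either `⟨𝓛̃U, φ⟩ = 0` (shell balance) or the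
quadratic stress `⟨W⊗W,∇φ⟩` is locked at size `≍ L(T−t)^{α−1}` per unit time forever. Same law
with `φ = g(B) curl U` and with Killing fields. -/
def WindowLaw : Prop :=
  ∀ ν : ℝ, 0 < ν → ∀ T : ℝ, 0 < T → ∀ (u : ℝ → E³ → E³) (p : ℝ → E³ → ℝ),
    IsClassicalNSSolutionOn (Set.Ico 0 T) ν 0 u p → IsLerayHopfOn T ν 0 (u 0) u →
    HasRapidSpatialDecay (u 0) →
    ∀ (U : E³ → E³) (P : E³ → ℝ), IsCompactSteadyEuler U P →
    ∀ α ∈ Set.Ioo (1 / 2 : ℝ) (3 / 4), ∀ ℓ : ℝ, 0 < ℓ → ∀ ξ : ℝ → E³,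
      TendstoLocallyUniformly (rescaled ν T α ℓ ξ u) U (𝓝[<] T) →
      (∀ᶠ t in 𝓝[<] T, DifferentiableAt ℝ ξ t) →
      (∀ᶠ t in 𝓝[<] T, ∀ j : Fin 3,
          ∫ y, inner ℝ (rescaled ν T α ℓ ξ u t y - U y)
              (fderiv ℝ U y (EuclideanSpace.single j (1 : ℝ))) = 0) →
      ∀ f : ℝ → ℝ, ContDiff ℝ (⊤ : ℕ∞) f →
        ∃ T₀ < T, ∀ t₁ t₂ : ℝ, T₀ ≤ t₁ → t₁ ≤ t₂ → t₂ < T →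
          (∫ y, inner ℝ (rescaled ν T α ℓ ξ u t₂ y - rescaled ν T α ℓ ξ u t₁ y)
              (f (bernoulli U P y) • U y)) =
            ∫ t in t₁..t₂,
              (((T - t) ^ (-α) / (ℓ * Real.sqrt (ν * (T - t)))) *
                  ∫ y, inner ℝ (rescaled ν T α ℓ ξ u t y - U y)
                    (fderiv ℝ (fun z => f (bernoulli U P z) • U z) y
                      (rescaled ν T α ℓ ξ u t y - U y))
                + (ℓ * (T - t))⁻¹ *
                  ∫ y, inner ℝ (rescaled ν T α ℓ ξ u t y)
                    (adjointDrift α ℓ (fun z => f (bernoulli U P z) • U z) y))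

/-- QUIET frozen eddies (the named rate gap): the `L²`-fluctuation on a ball containing the
profile's support decays faster than the inverse square root of the eddy time, in log-average:
`∫_{T₀}^{T} (T−t)^{−α}/L(t) · ‖V(t) − U‖²_{L²(B_R)} dt < ∞` (equivalently: the error energy in the
eddy ball is `o((T−t)^{1−α})` against the log-measure `dt/(T−t)`). Under the crux's hypotheses
alone this is NOT derivable (locked noise fed by exterior tidal pressure is formally allowed);
it is the minimal extra information the shell-balance line needs. -/
def IsQuiet (ν T α ℓ R : ℝ) (ξ : ℝ → E³) (u : ℝ → E³ → E³) (U : E³ → E³) : Prop :=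
  ∃ T₀ < T, IntegrableOn
    (fun t => ((T - t) ^ (-α) / (ℓ * Real.sqrt (ν * (T - t)))) *
      ∫ y in Metric.ball (0 : E³) R, ‖rescaled ν T α ℓ ξ u t y - U y‖ ^ 2)
    (Set.Ico T₀ T)

/-- COMPOSITION TARGET for crux-plan (informal skeleton, stated as one Prop): quietness on some
ball containing `supp U` + `WindowLaw` (and its helicity twin) ⇒ (E) ∧ (H) for `U`;
`NoShellBalance` ⇒ `U = 0`. The crux itself then needs the separate stub
"hypotheses ∧ U ≠ 0 ⇒ quiet along a recentred path" (the rate gap, honestly named). -/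
def crux_of_quiet : Prop :=
  WindowLaw → NoShellBalance →
  ∀ ν : ℝ, 0 < ν → ∀ T : ℝ, 0 < T → ∀ (u : ℝ → E³ → E³) (p : ℝ → E³ → ℝ),
    IsClassicalNSSolutionOn (Set.Ico 0 T) ν 0 u p → IsLerayHopfOn T ν 0 (u 0) u →
    HasRapidSpatialDecay (u 0) →
    ∀ (U : E³ → E³) (P : E³ → ℝ), IsCompactSteadyEuler U P →
    ∀ α ∈ Set.Ioo (1 / 2 : ℝ) (3 / 4), ∀ ℓ : ℝ, 0 < ℓ → ∀ ξ : ℝ → E³,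
      TendstoLocallyUniformly (rescaled ν T α ℓ ξ u) U (𝓝[<] T) →
      (∀ R : ℝ, tsupport U ⊆ Metric.ball 0 R → IsQuiet ν T α ℓ R ξ u U) → U = 0

/-- Sanity: the crux's profile hypotheses are exactly `IsCompactSteadyEuler` (so the decls above
plug into `AdiabaticEddy.NoFrozenEddyCollapse` without glue). -/
theorem noFrozenEddyCollapse_iff :
    Summit.NavierStokesRegularity.NavierStokesRegularity.Theses.AdiabaticEddy.NoFrozenEddyCollapse ↔
    ∀ ν : ℝ, 0 < ν → ∀ T : ℝ, 0 < T → ∀ (u : ℝ → E³ → E³) (p : ℝ → E³ → ℝ),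
      IsClassicalNSSolutionOn (Set.Ico 0 T) ν 0 u p → IsLerayHopfOn T ν 0 (u 0) u →
      HasRapidSpatialDecay (u 0) →
      ∀ (U : E³ → E³) (P : E³ → ℝ), IsCompactSteadyEuler U P →
      ∀ α ∈ Set.Ioo (1 / 2 : ℝ) (3 / 4), ∀ ℓ : ℝ, 0 < ℓ → ∀ ξ : ℝ → E³,
        TendstoLocallyUniformly (rescaled ν T α ℓ ξ u) U (𝓝[<] T) → U = 0 := by
  unfold Summit.NavierStokesRegularity.NavierStokesRegularity.Theses.AdiabaticEddy.NoFrozenEddyCollapse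
    IsCompactSteadyEuler rescaled
  constructor
  · intro h ν hν T hT u p hcl hLH hdec U P hUP α hα ℓ hℓ ξ hconv
    exact h ν hν T hT u p hcl hLH hdec U P hUP.1 hUP.2.1 hUP.2.2.1 hUP.2.2.2.1 hUP.2.2.2.2 α hα ℓ hℓ
      ξ hconv
  · intro h ν hν T hT u p hcl hLH hdec U P hU hP hK hdiv hE α hα ℓ hℓ ξ hconv
    exact h ν hν T hT u p hcl hLH hdec U P ⟨hU, hP, hK, hdiv, hE⟩ α hα ℓ hℓ ξ hconv

end Summit.NavierStokesRegularity.NavierStokesRegularity.Cruxes.NoFrozenEddyCollapse.ShellBalanceEdgeTorsion
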